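import Literature.AnabelianGeometry.EtaleTheta.Discharge.Sec2GalExtensionProofs
import Literature.AnabelianGeometry.EtaleTheta.RigidOfSetting
import Literature.AnabelianGeometry.EtaleTheta.TowerOfSetting

/-!
# [EtTh] Prop 2.14 (ii) and Cor 2.18 (ii) for the §1 model: the instantiated rigidity data

Mochizuki, *The Étale Theta Function …* [EtTh], Publ. RIMS 45 (2009), §2, Prop 2.14 (ii) (PRIMS PDF
p.49) and Cor 2.18 (ii) (p.59) (locators `p.N` = PDF pages; bib key `MochizukiEtTh2009`). PROOF-ONLY;
seat abc-iut-L2-t10 (unit "deep EtTh:Prop2.14(ii)-model (hgal)"), capstone over abc-iut-L2-t8's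
`RigidOfSetting.lean` (`rigidData`) and `TowerOfSetting.lean` (`CyclotomeTower`).

For abc-iut-L2-t8's §1 instantiation `C.rigidData μ hC hS h15 L : RigidData N l` of abc-iut-L2-t2's
rigidity interface (`ThetaRigidity.lean`), the named facts `Prop214_ii` and `Cor218_ii` HOLD —
conditional only on abc-iut-L2-t1's named §1 facts `Prop15iii` (already an input of `rigidData`) and
`Prop15ii` ([EtTh] Prop 1.5 (ii), (iii) — the printed dependency "cf. Proposition 1.5, (ii), (iii)",
p.49):

* at every level `M` of a compatible system of cyclotomes `τ : D.CyclotomeTower l E` (p.46 "the natural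
  isomorphism `μ_N ≅ (l·Δ_Θ) ⊗ ℤ/Nℤ`", level-wise `Δ_Θ ≅ Ẑ(1)`): `rigidData_prop214_ii`,
  `rigidData_cor218_ii` — the `2`-torsion hypothesis `H2` of `Discharge/Sec2GalExtensionProofs.lean` is
  discharged by t8's `CyclotomeTower.red_eq_one_of_sq_eq_one`;
* at a single abstract level `μ : D.CyclotomeMod l N`, with `H2` as an explicit binder:
  `rigidData_prop214_ii_of_H2`, `rigidData_cor218_ii_of_H2`.

HONEST FRAMING: [EtTh] is refereed; OUR kernel check of the printed reduction Prop 1.5 ⇒ Prop 2.14 (ii)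
⇒ Cor 2.18 (ii) for the model; `Prop15ii`/`Prop15iii` are named (unproved) facts and the structures
`ThetaSetting`/`EtaleThetaData`/`DoubleUnderline`/`CyclotomeTower`/`CuspLabels` are data quoting print,
asserted to exist for no curve; no side is taken on [IUTchIII] Cor 3.12.
-/

noncomputable section

namespace Literature.AnabelianGeometry.EtaleTheta

namespace ThetaSetting

namespace EtaleThetaData.DoubleUnderline

variable {p : ℕ} [Fact p.Prime] {D : ThetaSetting p} {E : D.EtaleThetaData} {l : ℕ}
  (C : E.DoubleUnderline l)

/-- **[EtTh] Prop 2.14 (ii) for the §1 model at one level**, with the `2`-torsion hypothesis `H2` on the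
level-`N` cyclotome explicit. [cite: MochizukiEtTh2009, Prop 2.14(ii) p.49] -/
theorem rigidData_prop214_ii_of_H2 {N : ℕ+} (μ : D.CyclotomeMod l N) (hC : D.Compat) (hS : D.Sec2Hyps)
    (h15 : Prop15iii E hC) (h15ii : Prop15ii E.toKummerData hC) (L : C.CuspLabels)
    (H2 : ∀ t : D.lDeltaTheta l, t ^ 2 = 1 → μ.red t = 1) :
    (C.rigidData μ hC hS h15 L).Prop214_ii :=
  C.prop214_ii_of_model μ hC hS h15 h15ii H2 _ rfl

/-- **[EtTh] Cor 2.18 (ii) for the §1 model at one level**, with `H2` explicit.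
[cite: MochizukiEtTh2009, Cor 2.18(ii) p.59] -/
theorem rigidData_cor218_ii_of_H2 {N : ℕ+} (μ : D.CyclotomeMod l N) (hC : D.Compat) (hS : D.Sec2Hyps)
    (h15 : Prop15iii E hC) (h15ii : Prop15ii E.toKummerData hC) (L : C.CuspLabels)
    (H2 : ∀ t : D.lDeltaTheta l, t ^ 2 = 1 → μ.red t = 1) :
    (C.rigidData μ hC hS h15 L).Cor218_ii :=
  C.cor218_ii_of_model μ hC hS h15 h15ii H2 _ rfl

variable {Es : Set ℕ+} (τ : D.CyclotomeTower l Es)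

/-- **[EtTh] Prop 2.14 (ii) for the §1 model** at every level `M` of a compatible system of cyclotomes
(abc-iut-L2-t8's `CyclotomeTower`; `H2` discharged by `CyclotomeTower.red_eq_one_of_sq_eq_one`),
conditional only on Prop 1.5 (ii), (iii) as named facts. [cite: MochizukiEtTh2009, Prop 2.14(ii) p.49] -/
theorem rigidData_prop214_ii (M : Es) (hC : D.Compat) (hS : D.Sec2Hyps) (h15 : Prop15iii E hC)
    (h15ii : Prop15ii E.toKummerData hC) (L : C.CuspLabels) :
    (C.rigidData (τ.mod M) hC hS h15 L).Prop214_ii :=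
  C.rigidData_prop214_ii_of_H2 (τ.mod M) hC hS h15 h15ii L (τ.red_eq_one_of_sq_eq_one M)

/-- **[EtTh] Cor 2.18 (ii) for the §1 model** at every level of a `CyclotomeTower`, conditional only on
Prop 1.5 (ii), (iii) as named facts. [cite: MochizukiEtTh2009, Cor 2.18(ii) p.59] -/
theorem rigidData_cor218_ii (M : Es) (hC : D.Compat) (hS : D.Sec2Hyps) (h15 : Prop15iii E hC)
    (h15ii : Prop15ii E.toKummerData hC) (L : C.CuspLabels) :
    (C.rigidData (τ.mod M) hC hS h15 L).Cor218_ii :=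
  C.rigidData_cor218_ii_of_H2 (τ.mod M) hC hS h15 h15ii L (τ.red_eq_one_of_sq_eq_one M)

end EtaleThetaData.DoubleUnderline

end ThetaSetting

end Literature.AnabelianGeometry.EtaleTheta

end
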